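import Mathlib.GroupTheory.OrderOfElement
import Mathlib.Analysis.SpecialFunctions.Log.Basic
import Mathlib.Analysis.Normed.Field.Basic
import Mathlib.Analysis.Complex.Basic
import Mathlib.NumberTheory.Padics.PadicIntegers
import Literature.IUT.HodgeArakelov.ThetaGauLinks
import Literature.IUT.HodgeArakelov.ThetaValueOrbits

/-!
# [IUTchII] §3, Remarks 3.5.1, 3.6.2 (iii), 3.6.3 (ii), 3.6.4 (i)/(iii)/(iv), 3.8.3 (i)/(ii):
# kernel shadows of the small printed clauses — PROOF-ONLY companion

S. Mochizuki, *Inter-universal Teichmüller theory II*, §3 (kurims Dec-2020 manuscript pp. 93–119)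
[cite: Mochizuki2012, Rmk 3.6.4 p.105]. Claim key DISPUTED (D-0012). PROOF-ONLY file (abc-iut cell, layer
L6, seat abc-iut-L6-t8 gen 7, row «IUTchII-RMK34-38-COVERAGE»): NO `def`, NO instance, NO named `Prop`
fact. The §3 Remarks 3.4.1–3.8.3 are typed in the tree as NAMED SLOTS (`ExpositoryRemarks`,
`TemperedThetaMonoids.RadialityStatements`, `BadPrime.Remark353Statement`, `Cor35Statements`,
`ConjugateSynchronizationPrinciple`) plus the PROVED combinatorial model of Rmk 3.5.2 (i)
(`SymmetryCombinatorics`, `TwoPointModel.*`) and the theta exponents of Rmk 3.6.2 (iii)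
(`ThetaGauLinks`, `thetaExponent*`). The remarks are mostly expository; this file proves, over Mathlib
and the landed vocabulary only, the handful of printed sentences inside them that have an elementary
mathematical content not yet present as a kernel declaration — each labelled honestly as a KERNEL
SHADOW of the quoted sentence (the printed objects `K_v`, `Θ`-pilot objects, `Ψ_cns`, … are replaced by
the elementary structures named in each statement; nothing about mono-theta environments is claimed):

* §1 Rmk 3.5.1 (i) p. 96 — "we took `γ` to be `= 1` … does not result in any substantive loss of
  generality … the `δ` … is arbitrary, i.e., it is subject to the independent conjugation indeterminacies
  discussed in Corollary 2.5, (iii)": at abc-iut-L6-t4's typing of Cor 2.8 (ii)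
  (`ThetaValueOrbits.Cor28ii_functorialAlgorithm`: the output is CONSTANT in the two independent
  conjugate choices) any conjugate choice may be replaced by a fixed one
  (`outputs_eq_of_cor28ii`, `functorial_at_fixed_choice_of_cor28ii`).
* §2 Rmk 3.6.2 (iii) p. 103 — the correspondence `q_v ↦ {q_v^{j²}}_{1≤j≤l⋇}` "as a sort of «homotopy»
  between the identity `q_v ↦ q_v` … and … `q_v ↦ q_v^{(l⋇)²}`", with "highly distinguished" exponents,
  and Rmk 3.5.2 (ii) (b) p. 98 "the Gaussian monoids [i.e., which involve distinct values at distinct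
  labels!]": `pow_thetaExponent_label_one/_top`, `thetaExponent_strictMono/_injective`, and
  injectivity of `j ↦ q^{j²}` for `q` of infinite order (`pow_thetaExponent_injective_of_not_isOfFinOrder`)
  or of norm `< 1` in a normed field (`pow_thetaExponent_injective_of_norm_lt_one`) — the Tate-parameter
  situation `|q_v| < 1`.
* §3 Rmk 3.6.3 (ii) p. 104 "these `N`-th power morphisms of monoids fail [since `N > 1`] to preserve the
  ring structure of `K_v`" / Rmk 3.6.4 (i) p. 106 "the `N`-th power morphisms are compatible with the
  multiplicative structure, but not the additive structure": in any characteristic-zero commutative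
  semiring the `N`-th power map (`N ≥ 2`) IS a monoid homomorphism and is NOT additive
  (`nthPower_multiplicative_not_additive`, `not_exists_ringHom_eq_nthPower`; witness `(1+1)^N ≠ 1^N+1^N`).
* §4 Rmk 3.6.4 (iii)/(iv) p. 107 "the `N`-th power … is only defined as the `N`-th power «`(−)^N`» of the
  first power", as used at [IUTchIII] Cor 3.12 Step (xi-h) (kurims III p. 185): "the log-volume of such an
  `N`-th tensor power … must always be computed as the result of multiplying the log-volume of the
  original … by `N`": `log_norm_pow` (`log ‖x^N‖ = N · log ‖x‖` in any normed division ring).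
* §5 Rmk 3.8.3 (i) p. 117 "(b) and (c) may be thought of as formal consequences of (a)": from label
  isomorphisms `N_t ≃* M` ((a)) one CONSTRUCTS the diagonal submonoid of `∏_t N_t` ((b)) and the
  isomorphism of the copy at any fixed label with the diagonal ((c)) (`exists_diagonal_of_labelIsos`).
* §6 Rmk 3.8.3 (ii) p. 118 "the operation of passing to sets of Galois-orbits fails to be compatible with
  the ring structure — e.g., the additive structure": for the Galois group of `ℂ/ℝ` (complex
  conjugation) the orbit of a sum is not determined by the orbits of the summands
  (`conj_orbits_not_additive`, witness `i + i` vs `i + (−i)`).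

Nothing here bears on [IUTchIII] Cor 3.12 beyond the elementary identities named; no side is taken on any
author; typed ≠ proved ≠ endorsed.
-/

namespace Literature.IUT.HodgeArakelov

namespace Sec3Remarks

open Function

universe u v w

/-! ### §1. Remark 3.5.1 (i): "`γ = 1` … does not result in any substantive loss of generality" -/

/-- **IUTchII:Rmk3.5.1(i)** (kurims p. 96 l. 5–15), KERNEL SHADOW at the typed Cor 2.8 (ii): in
`ThetaValueOrbits.Cor28ii_functorialAlgorithm out out' φ` the output `out γ₁ γ₂` of the evaluation
algorithm is "compatible with the independent conjugacy actions", i.e. constant in the two conjugate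
choices; hence the value at ANY pair of choices equals the value at any FIXED pair ("one may always
simply take the «`M^Θ_*`» of Corollary 3.5 to be the «`(M^Θ_*)^γ`» of Corollary 2.8 … the «`δ`» … is
arbitrary"). [cite: Mochizuki2012, Rmk 3.5.1 (i) p.96] -/
theorem outputs_eq_of_cor28ii {LabAbs : Type u} {HG : Type v} [AddCommGroup HG]
    {Conj₁ Conj₂ : Type u} {out : Conj₁ → Conj₂ → LabAbs → Set HG}
    {HG' : Type v} {out' : LabAbs → Set HG'} {φ : HG → HG'}
    (h : ThetaValueOrbits.Cor28ii_functorialAlgorithm out out' φ)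
    (γ₁ : Conj₁) (γ₂ : Conj₂) (γ₁₀ : Conj₁) (γ₂₀ : Conj₂) : out γ₁ γ₂ = out γ₁₀ γ₂₀ :=
  h.1 γ₁ γ₁₀ γ₂ γ₂₀

/-- **IUTchII:Rmk3.5.1(i)** (kurims p. 96), KERNEL SHADOW, functoriality clause at a fixed choice: the
second clause of `Cor28ii_functorialAlgorithm` ("functorial in the projective system of mono-theta
environments") read at one fixed pair of conjugate choices `(γ₁₀, γ₂₀)` — the normalisation "`γ = 1`".
[cite: Mochizuki2012, Rmk 3.5.1 (i) p.96] -/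
theorem functorial_at_fixed_choice_of_cor28ii {LabAbs : Type u} {HG : Type v} [AddCommGroup HG]
    {Conj₁ Conj₂ : Type u} {out : Conj₁ → Conj₂ → LabAbs → Set HG}
    {HG' : Type v} {out' : LabAbs → Set HG'} {φ : HG → HG'}
    (h : ThetaValueOrbits.Cor28ii_functorialAlgorithm out out' φ) (γ₁₀ : Conj₁) (γ₂₀ : Conj₂)
    (a : LabAbs) : out' a = φ '' out γ₁₀ γ₂₀ a :=
  h.2 γ₁₀ γ₂₀ a

/-! ### §2. Remark 3.6.2 (iii): `q_v ↦ {q_v^{j²}}` as a "homotopy" between the identity and `q ↦ q^{(l⋇)²}` -/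

/-- **IUTchII:Rmk3.6.2(iii)** (kurims p. 103 l. 16–22) "· the identity `q_v ↦ q_v` [i.e., which
corresponds to «characteristic zero»]": at the label `j = 1` the correspondence `q ↦ q^{j²}` is the
identity map of any monoid (`thetaExponent_label_one`, abc-iut-L6-t2).
[cite: Mochizuki2012, Rmk 3.6.2 (iii) p.103] -/
theorem pow_thetaExponent_label_one {M : Type u} [Monoid M] {lstar : ℕ} (h : 0 < lstar) (q : M) :
    q ^ thetaExponent (⟨0, h⟩ : Fin lstar) = q := by
  rw [thetaExponent_label_one h, pow_one]

/-- **IUTchII:Rmk3.6.2(iii)** (kurims p. 103 l. 24–30) "· the purely monoid-theoretic/highly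
non-scheme-theoretic correspondence `q_v ↦ q_v^{(l⋇)²}` [i.e., which corresponds to the «positive
characteristic Frobenius morphism»]": at the top label the correspondence is the `(l⋇)²`-th power map
(`thetaExponent_label_top`). [cite: Mochizuki2012, Rmk 3.6.2 (iii) p.103] -/
theorem pow_thetaExponent_label_top {M : Type u} [Monoid M] {lstar : ℕ} (h : 0 < lstar) (q : M) :
    q ^ thetaExponent (⟨lstar - 1, Nat.sub_lt h Nat.one_pos⟩ : Fin lstar) = q ^ (lstar ^ 2) := by
  rw [thetaExponent_label_top h]

/-- **IUTchII:Rmk3.6.2(iii)** (kurims p. 103 l. 31–33) "the collection of exponents `{j²}_{1≤j≤l⋇}` … is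
highly distinguished — hence, in particular, far from arbitrary!": the exponents are STRICTLY INCREASING
in the label. [cite: Mochizuki2012, Rmk 3.6.2 (iii) p.103] -/
theorem thetaExponent_strictMono (lstar : ℕ) : StrictMono (thetaExponent (lstar := lstar)) := by
  intro i j hij
  have hij' : i.val < j.val := hij
  unfold thetaExponent
  exact Nat.pow_lt_pow_left (Nat.succ_lt_succ hij') two_ne_zero

/-- **IUTchII:Rmk3.6.2(iii)** (kurims p. 103): distinct labels carry distinct exponents `j²`.
[cite: Mochizuki2012, Rmk 3.6.2 (iii) p.103] -/
theorem thetaExponent_injective (lstar : ℕ) : Injective (thetaExponent (lstar := lstar)) :=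
  (thetaExponent_strictMono lstar).injective

/-- **IUTchII:Rmk3.5.2(ii)** (b) (kurims p. 98 l. 32–33) "the Gaussian monoids [i.e., which involve
distinct values at distinct labels!]", KERNEL SHADOW: for an element `q` of INFINITE ORDER of a
left-cancellative monoid, the theta values `q^{j²}` at distinct labels are distinct.
[cite: Mochizuki2012, Rmk 3.5.2 (ii) p.98] -/
theorem pow_thetaExponent_injective_of_not_isOfFinOrder {M : Type u} [LeftCancelMonoid M] {q : M}
    (hq : ¬ IsOfFinOrder q) (lstar : ℕ) :
    Injective (fun j : Fin lstar => q ^ thetaExponent j) :=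
  (injective_pow_iff_not_isOfFinOrder.mpr hq).comp (thetaExponent_injective lstar)

/-- **IUTchII:Rmk3.6.2(iii)** / **Rmk3.5.2(ii)** (b), KERNEL SHADOW in the Tate-parameter situation
`0 < |q_v| < 1` of a nonarchimedean local field (here: any normed field): the norms `‖q^{j²}‖` are
STRICTLY DECREASING in the label. [cite: Mochizuki2012, Rmk 3.6.2 (iii) p.103] -/
theorem norm_pow_thetaExponent_strictAnti {K : Type u} [NormedField K] {q : K} (hq0 : q ≠ 0)
    (hq1 : ‖q‖ < 1) (lstar : ℕ) : StrictAnti (fun j : Fin lstar => ‖q ^ thetaExponent j‖) := by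
  intro i j hij
  simp only [norm_pow]
  exact pow_right_strictAnti₀ (norm_pos_iff.mpr hq0) hq1 (thetaExponent_strictMono lstar hij)

/-- **IUTchII:Rmk3.5.2(ii)** (b) / **Rmk3.6.2(iii)**, KERNEL SHADOW: for `0 < |q_v| < 1` in a normed
field the theta values `q_v^{j²}` at distinct labels `j` are distinct.
[cite: Mochizuki2012, Rmk 3.5.2 (ii) p.98] -/
theorem pow_thetaExponent_injective_of_norm_lt_one {K : Type u} [NormedField K] {q : K} (hq0 : q ≠ 0)
    (hq1 : ‖q‖ < 1) (lstar : ℕ) : Injective (fun j : Fin lstar => q ^ thetaExponent j) := by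
  intro i j hij
  have := (norm_pow_thetaExponent_strictAnti hq0 hq1 lstar).injective
  exact this (by simpa using congrArg (fun x : K => ‖x‖) hij)

/-! ### §3. Remarks 3.6.3 (ii), 3.6.4 (i): the `N`-th power map is multiplicative, not additive -/

/-- **IUTchII:Rmk3.6.4(i)** (kurims p. 106 l. 18–20) "the `N`-th power morphisms are compatible with the
multiplicative structure, but not the additive structure of such rational functions", KERNEL SHADOW,
the witness: in a characteristic-zero semiring, `(1+1)^N ≠ 1^N + 1^N` once `N ≥ 2`.
[cite: Mochizuki2012, Rmk 3.6.4 (i) p.106] -/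
theorem one_add_one_pow_ne {R : Type u} [Semiring R] [CharZero R] {N : ℕ} (hN : 2 ≤ N) :
    ((1 : R) + 1) ^ N ≠ (1 : R) ^ N + 1 ^ N := by
  have h2N : (2 : ℕ) < 2 ^ N := by
    calc (2 : ℕ) = 2 ^ 1 := (pow_one 2).symm
      _ < 2 ^ N := Nat.pow_lt_pow_right (by norm_num) (by omega)
  intro h
  have h' : ((2 ^ N : ℕ) : R) = ((2 : ℕ) : R) := by
    simpa [one_add_one_eq_two] using h
  exact (Nat.ne_of_gt h2N) (Nat.cast_injective h')

/-- **IUTchII:Rmk3.6.4(i)** (kurims p. 106 l. 18–20) / **Rmk3.6.3(ii)** (p. 104 l. 41–42), KERNEL SHADOW: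
over any characteristic-zero commutative semiring `R` (e.g. `K_v`, `𝒪_{K_v}`) and `N ≥ 2`, the
`N`-th power map `x ↦ x^N` IS a homomorphism of multiplicative monoids ("compatible with the multiplicative
structure") and is NOT a homomorphism of additive monoids ("but not the additive structure").
[cite: Mochizuki2012, Rmk 3.6.4 (i) p.106] -/
theorem nthPower_multiplicative_not_additive (R : Type u) [CommSemiring R] [CharZero R] {N : ℕ}
    (hN : 2 ≤ N) :
    (∃ f : R →* R, ∀ x, f x = x ^ N) ∧ ¬ ∃ g : R →+ R, ∀ x, g x = x ^ N := by
  refine ⟨⟨powMonoidHom N, fun x => rfl⟩, ?_⟩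
  rintro ⟨g, hg⟩
  apply one_add_one_pow_ne (R := R) hN
  rw [← hg, map_add, hg]

/-- **IUTchII:Rmk3.6.3(ii)** (kurims p. 104 l. 41–42) "these `N`-th power morphisms of monoids fail
[since `N > 1`] to preserve the ring structure of `K_v`", KERNEL SHADOW: for `N ≥ 2` no ring endomorphism
of a characteristic-zero commutative semiring is the `N`-th power map.
[cite: Mochizuki2012, Rmk 3.6.3 (ii) p.104] -/
theorem not_exists_ringHom_eq_nthPower (R : Type u) [CommSemiring R] [CharZero R] {N : ℕ}
    (hN : 2 ≤ N) : ¬ ∃ h : R →+* R, ∀ x, h x = x ^ N := by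
  rintro ⟨h, hh⟩
  exact (nthPower_multiplicative_not_additive R hN).2 ⟨h.toAddMonoidHom, fun x => hh x⟩

/-- **IUTchII:Rmk3.6.3(ii)** at the `p_v`-adic integers and numbers (`K_v = ℚ_p` shadow): the `N`-th power
map of `ℤ_[p]`, resp. `ℚ_[p]`, is multiplicative and not additive for `N ≥ 2`.
[cite: Mochizuki2012, Rmk 3.6.3 (ii) p.104] -/
theorem nthPower_padic_not_additive (p : ℕ) [Fact p.Prime] {N : ℕ} (hN : 2 ≤ N) :
    ((∃ f : ℤ_[p] →* ℤ_[p], ∀ x, f x = x ^ N) ∧ ¬ ∃ g : ℤ_[p] →+ ℤ_[p], ∀ x, g x = x ^ N) ∧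
      ((∃ f : ℚ_[p] →* ℚ_[p], ∀ x, f x = x ^ N) ∧ ¬ ∃ g : ℚ_[p] →+ ℚ_[p], ∀ x, g x = x ^ N) :=
  ⟨nthPower_multiplicative_not_additive ℤ_[p] hN, nthPower_multiplicative_not_additive ℚ_[p] hN⟩

/-! ### §4. Remark 3.6.4 (iii)/(iv) and [IUTchIII] Cor 3.12 Step (xi-h): log-volume of an `N`-th power -/

/-- **IUTchII:Rmk3.6.4(iv)** (kurims p. 107 l. 29–34) "the `N`-th power of the … theta function, for
`N > 1`, is only defined as the `N`-th power «`(−)^N`» of the first power", as consumed at [IUTchIII]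
Cor 3.12 Step (xi-h) (kurims III p. 185): "the log-volume of such an `N`-th tensor power of a Θ-pilot
object must always be computed as the result of multiplying the log-volume of the original Θ-pilot object
by `N`". KERNEL SHADOW (one element of a normed division ring in place of a pilot object, `log ‖·‖` in
place of the log-volume): `log ‖x^N‖ = N · log ‖x‖`. [cite: Mochizuki2012, Rmk 3.6.4 (iv) p.107] -/
theorem log_norm_pow {K : Type u} [NormedDivisionRing K] (x : K) (N : ℕ) :
    Real.log ‖x ^ N‖ = N * Real.log ‖x‖ := by
  rw [norm_pow, Real.log_pow]

/-! ### §5. Remark 3.8.3 (i): "(b) and (c) may be thought of as formal consequences of (a)" -/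

/-- **IUTchII:Rmk3.8.3(i)** (kurims p. 117 l. 58–59) "(b) [the diagonal submonoids
`Ψ_cns(M^Θ_*)_{⟨|F_l|⟩} ⊆ ∏_{|t|} Ψ_cns(M^Θ_*)_{|t|}`] and (c) [the isomorphisms `Ψ_cns(M^Θ_*)_0 ⥲ Ψ_cns(M^Θ_*)_{⟨F_l^⋇⟩}`]
may be thought of as formal consequences of (a) [the isomorphisms `Ψ_cns(M^Θ_*)_{|t₁|} ⥲ Ψ_cns(M^Θ_*)_{|t₂|}`]",
KERNEL SHADOW: given a family of monoids `N t` indexed by labels `t : T` and label isomorphisms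
`e t : N t ≃* M` with one monoid `M` ((a): the isomorphisms `N t₁ ⥲ M ⥲ N t₂`), there is a submonoid `D` of
`∏_t N t` consisting exactly of the tuples `((e t)⁻¹ m)_t` ((b), the diagonal), and for every label `t₀`
an isomorphism `N t₀ ≃* D` whose `t`-component is the label isomorphism `N t₀ ⥲ N t` ((c)).
[cite: Mochizuki2012, Rmk 3.8.3 (i) p.117] -/
theorem exists_diagonal_of_labelIsos {T : Type u} {M : Type v} [CommMonoid M]
    (N : T → Type w) [∀ t, CommMonoid (N t)] (e : ∀ t, N t ≃* M) :
    ∃ D : Submonoid (∀ t, N t),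
      (∀ x : ∀ t, N t, x ∈ D ↔ ∃ m : M, ∀ t, x t = (e t).symm m) ∧
      ∀ t₀ : T, ∃ ι : N t₀ ≃* D, ∀ (n : N t₀) (t : T), (ι n : ∀ t, N t) t = (e t).symm (e t₀ n) := by
  classical
  let D : Submonoid (∀ t, N t) :=
    { carrier := {x | ∃ m : M, ∀ t, x t = (e t).symm m}
      mul_mem' := by
        rintro x y ⟨m, hm⟩ ⟨m', hm'⟩
        refine ⟨m * m', fun t => ?_⟩
        rw [Pi.mul_apply, hm t, hm' t, map_mul]
      one_mem' := ⟨1, fun t => by rw [Pi.one_apply, map_one]⟩ }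
  refine ⟨D, fun x => Iff.rfl, fun t₀ => ?_⟩
  let f : N t₀ →* (∀ t, N t) :=
    { toFun := fun n t => (e t).symm (e t₀ n)
      map_one' := by funext t; simp
      map_mul' := fun a b => by funext t; simp [map_mul] }
  have hf : ∀ n, f n ∈ D := fun n => ⟨e t₀ n, fun t => rfl⟩
  have hinj : Injective (f.codRestrict D hf) := by
    intro a b hab
    have h := congrArg (fun d : D => (d : ∀ t, N t) t₀) hab
    simpa [f] using h
  have hsurj : Surjective (f.codRestrict D hf) := by
    rintro ⟨x, m, hm⟩
    refine ⟨(e t₀).symm m, Subtype.ext ?_⟩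
    funext t
    simp [f, hm t]
  exact ⟨MulEquiv.ofBijective (f.codRestrict D hf) ⟨hinj, hsurj⟩, fun n t => rfl⟩

/-! ### §6. Remark 3.8.3 (ii): Galois-orbits versus the additive structure -/

/-- **IUTchII:Rmk3.8.3(ii)** (kurims p. 118 l. 28–30) "the operation of passing to sets of Galois-orbits
fails to be compatible with the ring structure — e.g., the additive structure — on … the various constant
monoids", KERNEL SHADOW at the smallest Galois group, `Gal(ℂ/ℝ) = {1, conj}`: the elements `i` and `−i`
have the SAME Galois-orbit, but `i + i` and `i + (−i)` have DIFFERENT Galois-orbits — so "orbit of a sum"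
is not determined by the orbits of the summands. [cite: Mochizuki2012, Rmk 3.8.3 (ii) p.118] -/
theorem conj_orbits_not_additive :
    ∃ z w w' : ℂ, ({w, (starRingEnd ℂ) w} : Set ℂ) = {w', (starRingEnd ℂ) w'} ∧
      ({z + w, (starRingEnd ℂ) (z + w)} : Set ℂ) ≠ {z + w', (starRingEnd ℂ) (z + w')} := by
  refine ⟨Complex.I, Complex.I, -Complex.I, ?_, ?_⟩
  · rw [Complex.conj_I, map_neg, Complex.conj_I, neg_neg, Set.pair_comm]
  · intro h
    have hmem : Complex.I + Complex.I ∈ ({Complex.I + -Complex.I,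
        (starRingEnd ℂ) (Complex.I + -Complex.I)} : Set ℂ) := by
      rw [← h]; exact Set.mem_insert _ _
    -- `I + I ∈ {0, conj 0}` forces `I + I = 0`, contradicting `I ≠ 0`
    simp [add_neg_cancel] at hmem

end Sec3Remarks

end Literature.IUT.HodgeArakelov
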